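import Literature.NumberTheory.EllipticCurves.MazurTateTeitelbaumDistribution
import Literature.NumberTheory.EllipticCurves.CuspClassPeriodRationality
import Literature.NumberTheory.EllipticCurves.PAdicMeasureMoments
import Literature.NumberTheory.EllipticCurves.PAdicLFunctionDistributionProofs
import Literature.NumberTheory.EllipticCurves.HidaFamilyMembersProofs
import Literature.NumberTheory.EllipticCurves.PadicSeriesEvaluation
import HarnessLib

/-!
# The Mazur–Tate–Teitelbaum `p`-adic `L`-function of an ordinary newform of weight `n + 2 ≥ 4`

Topic `Literature/NumberTheory/EllipticCurves`, namespace
`Literature.NumberTheory.EllipticCurves.ModularForms`.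

For a newform `g ∈ S_{n+2}(Γ₀(N))` of even weight `n + 2 ≥ 4`, a prime `p ∤ N`, a field
`K' ⊆ ℂ` containing the coefficient field `K_g` together with a root `u` of the Hecke polynomial
`X² − a_p(g) X + p^{n+1}`, and an embedding `ι : K' → ℚ_p` under which `u` is a unit (`g` is
`ι`-ordinary, `u` the unit root), this file constructs the minus-part Mazur–Tate–Teitelbaum
measure of the `p`-stabilisation `F = g − (a_p − u) g(pz)` (`U_p F = uF`) and its `p`-adic Mellin
transform `L = L_p⁻(g, u; T) ∈ ℚ_p⟦T⟧`, and proves the interpolation property at the characters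
`x ↦ ⟨x⟩ʲ` of `ℤ_p^×` (`0 ≤ j ≤ n`, `τ ∣ j`):

  `L(γʲ − 1) = ι( (1 − pʲ/u)(1 − p^{n−j}/u) · Im(i^{j+1} Λ(g, j+1)) / Ω⁻_g )`

(`exists_mtt_powerSeries_weightK`; Mazur–Tate–Teitelbaum 1986, §I.14 (14.3) with `χ = 1`;
Delbourgo 2008, Thm. 2.2; Bellaïche, *The Eigenbook*, §6.7.3, Thm. 6.7.9).  Here
`Λ(g, s) = ∫₀^∞ g(it) t^{s−1} dt` is the tree's `completedLValue`, `Ω⁻_g ∈ ℝ^×` is the period of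
Shimura's theorem (`IsNewform0.exists_re_im_mem_span_cuspidalLatticeK`: the imaginary parts of the
`K_g`-plane of cuspidal period values of `g` form `K_g Ω⁻_g`), `i^{j+1}Λ(g, j+1) ∈ K_g Ω⁻_g i` for
even `j`, `γ = 1 + p^{e₀}` and `τ = |(ℤ/p^{e₀})^×|` (`cyclotomicGenerator`, `torsionOrder`).  This is
the one-variable (weight-`k`) fibre of the two-variable interpolation of Greenberg–Stevens and
Kitagawa consumed by `Literature.NumberTheory.EllipticCurves.TwoVariablePadicLFunction`.

## Construction

* Complex side (`rayMoment_iota`, `integral_cuspRay_weight_eq_sum_rayMoment`,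
  `sum_integral_cuspRay_weight_heckeT`, `Wsum`, `sum_Wsum_iota_p`, `sum_Wsum_iota_one`): the
  binomially weighted sums `W_j(D; c, x) = ∑ₗ C(j,l) cˡ (−cx)^{j−l} ∫ₓ^{i∞} D(z) zˡ dz = ∫ₓ^{i∞} D(z)(cz − cx)ʲ dz`
  of the cusp ray moments of `D = ι₁ g, ι_p g` at `x = −a/pᵐ`, `c = pᵐ` (weight `(pᵐ z + a)ʲ`), and
  the two `U_p`-relations `U_p ι_p g = ι₁ g`, `U_p ι₁ g = a_p ι₁ g − p^{n+1} ι_p g` summed over the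
  `p` cusps `(x − t)/p` (the engine `sum_integral_cuspRay_div_eq` of `CuspRayIntegrals`).
* The functional (`imCoordSubmodule`, `imCoordPadic`): `λ(z) = ι(Im z / Ω)` on the `ℚ`-subspace of
  complex numbers with `K'`-rational `Ω i`-coordinate; `ℚ`-linear, `λ(a z) = ι(a) λ(z)` for REAL
  `a ∈ K'` (such as `a_p`), bounded on finitely generated subgroups (ultrametric).
* The distributions (`mttNu`): `ν_j(a + pᵐℤ_p) = ι(u)^{−m} [λ(W_j(ι₁ g)) − ι(a_p − u) λ(W_j(ι_p g))]`
  at the cusp `−a/pᵐ` — the stabilisation is formed AFTER projecting the periods of `g`, so that only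
  the real scalar `a_p` ever passes through `λ`; distribution relation `sum_fiber_mttNu`, bound
  `norm_mttNu_le` and admissibility `norm_mttNu_sub_pow_mul_le` from Manin's bounded denominators
  (`IsNewform0.exists_fg_rayMoment_rat_mem` of `CuspClassPeriodRationality`), values at the cusp `0`
  `mttNu_zero_sub_mttNu_one`.
* `p`-adic side: `PAdicMeasureMoments` (`exists_powerSeries_of_bounded_distribution'`,
  `hasSum_coeff_mul_cyclotomicGenerator_pow_sub_one`: `L_μ(γʲ − 1) = ν_j(ℤ_p) − ν_j(pℤ_p)`).

Convention: the ball `a + pᵐℤ_p` is paired with the cusp `−a/pᵐ` and the polynomial `(pᵐ z + a)ʲ`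
(Bellaïche §6.7.3, "only the fittest term survives: `b = −a`"); this is what makes the moment
family admissible (`ν_j(a + pᵐ) − aʲ ν_0(a + pᵐ) = O(p⁻ᵐ)`).  All definitions have bodies; there
are no named facts.

## References

* B. Mazur, J. Tate, J. Teitelbaum, *On `p`-adic analogues of the conjectures of Birch and
  Swinnerton-Dyer*, Invent. Math. 84 (1986), §I.10–I.14.
* D. Delbourgo, *Elliptic curves and big Galois representations*, LMS Lecture Note Ser. 356 (2008),
  Thm. 2.2.
* J. Bellaïche, *The Eigenbook*, Pathways in Mathematics (2021), §6.7.3, Thm. 6.7.9, Cor. 6.7.10.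
* M. M. Višik, *Non-archimedean measures connected with Dirichlet series*, Mat. Sb. 99 (1976).
* Ju. I. Manin, *Periods of parabolic forms and p-adic Hecke series*, Mat. Sb. 92 (1973), §1, Thm. 1.3.
* G. Shimura, *On the periods of modular forms*, Math. Ann. 229 (1977), Thm. 1.
-/

noncomputable section

open scoped MatrixGroups ModularForm Topology
open CongruenceSubgroup Complex MeasureTheory Set Filter
open UpperHalfPlane hiding I

namespace Literature.NumberTheory.EllipticCurves.ModularForms

/-! ### Complex side: weighted cusp-ray integrals, the degeneracy map, and the Hecke relation -/

section Complex

variable {L : ℕ} [NeZero L] {k : ℤ}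

omit [NeZero L] in
/-- **The cusp ray moments of `ι_d g`**: `∫ₓ^{i∞} g(dz) zˡ dz = d^{−(l+1)} ∫_{dx}^{i∞} g(w) wˡ dw`
(`w = dz`). [folklore] -/
theorem rayMoment_iota {M d : ℕ} [NeZero M] [NeZero d] (h : M * d ∣ L) (g : CuspForm (Gamma0 M) k)
    (l : ℕ) (x : ℝ) :
    rayMoment ⇑(iota M L d k h g) l x = ((d : ℂ) ^ (l + 1))⁻¹ * rayMoment ⇑g l (d * x) := by
  have hd : (0 : ℝ) < d := Nat.cast_pos.mpr (NeZero.pos d)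
  have hdC : (d : ℂ) ≠ 0 := by exact_mod_cast (NeZero.ne d)
  have key : ∀ t : ℝ, 0 < t → iota M L d k h g (ofComplex ((x : ℂ) + t * I)) =
      g (ofComplex (((d * x : ℝ) : ℂ) + ((d * t : ℝ) : ℂ) * I)) := by
    intro t ht
    have him : 0 < ((x : ℂ) + t * I).im := by simpa using ht
    have him' : 0 < ((((d * x : ℝ)) : ℂ) + ((d * t : ℝ) : ℂ) * I).im := by simpa using mul_pos hd ht
    rw [coe_iota_apply, ofComplex_apply_of_im_pos him']
    congr 1
    ext1
    simp only [ofComplex_apply_of_im_pos him, UpperHalfPlane.coe_mk]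
    push_cast
    ring
  set G : ℝ → ℂ := fun s ↦ g (ofComplex (((d * x : ℝ) : ℂ) + s * I)) *
    ((((d * x : ℝ) : ℂ) + s * I) / d) ^ l with hG
  have h1 : ∫ t in Ioi (0 : ℝ), iota M L d k h g (ofComplex ((x : ℂ) + t * I)) * ((x : ℂ) + t * I) ^ l =
      ∫ t in Ioi (0 : ℝ), G (d * t) := by
    refine setIntegral_congr_fun measurableSet_Ioi fun t ht ↦ ?_
    simp only [hG, key t ht]
    congr 1
    push_cast
    field_simp
  have h2 : ∫ s in Ioi (0 : ℝ), G s = ((d : ℂ) ^ l)⁻¹ *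
      ∫ s in Ioi (0 : ℝ), g (ofComplex (((d * x : ℝ) : ℂ) + s * I)) * (((d * x : ℝ) : ℂ) + s * I) ^ l := by
    rw [← integral_const_mul]
    refine setIntegral_congr_fun measurableSet_Ioi fun s _ ↦ ?_
    simp only [hG, div_pow]
    field_simp
  rw [rayMoment_def, rayMoment_def, h1, integral_comp_mul_left_Ioi G 0 hd, mul_zero, Complex.real_smul,
    h2, pow_succ]
  push_cast
  field_simp

/-- **The weighted cusp-ray integral in terms of the ray moments**: along `z = x + it`,
`ict = c(z − x)`, so `∫₀^∞ D(x + it)(ict)ʲ dt = −i ∑ₗ C(j,l) cˡ (−cx)^{j−l} ∫ₓ^{i∞} D(z) zˡ dz`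
(rational `x`, where every term is integrable). [folklore] -/
theorem integral_cuspRay_weight_eq_sum_rayMoment (D : CuspForm (Gamma0 L) k) (x : ℚ) (c : ℝ) (j : ℕ) :
    ∫ t in Ioi (0 : ℝ), D (ofComplex ((x : ℂ) + t * I)) * ((c : ℂ) * t * I) ^ j =
      -I * ∑ l ∈ Finset.range (j + 1), (j.choose l : ℂ) * (c : ℂ) ^ l * (-((c : ℂ) * x)) ^ (j - l) *
        rayMoment ⇑D l x := by
  have key : ∀ t : ℝ, D (ofComplex ((x : ℂ) + t * I)) * ((c : ℂ) * t * I) ^ j =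
      ∑ l ∈ Finset.range (j + 1), ((j.choose l : ℂ) * (c : ℂ) ^ l * (-((c : ℂ) * x)) ^ (j - l)) *
        (D (ofComplex ((x : ℂ) + t * I)) * ((x : ℂ) + t * I) ^ l) := by
    intro t
    have e : (c : ℂ) * t * I = (c : ℂ) * ((x : ℂ) + t * I) + (-((c : ℂ) * x)) := by ring
    rw [e, add_pow, Finset.mul_sum]
    refine Finset.sum_congr rfl fun l _ ↦ ?_
    rw [mul_pow]
    ring
  simp_rw [key]
  rw [integral_finsetSum _ (fun l _ ↦ (integrableOn_cuspRay_mul_pow_rat D x l).const_mul _),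
    Finset.mul_sum]
  refine Finset.sum_congr rfl fun l _ ↦ ?_
  rw [integral_const_mul, rayMoment_def]
  simp only [ofReal_ratCast]
  have hI : -I * ((j.choose l : ℂ) * (c : ℂ) ^ l * (-((c : ℂ) * x)) ^ (j - l) *
      (I * ∫ t in Ioi (0 : ℝ), D (ofComplex ((x : ℂ) + t * I)) * ((x : ℂ) + t * I) ^ l)) =
      (-(I * I)) * (((j.choose l : ℂ) * (c : ℂ) ^ l * (-((c : ℂ) * x)) ^ (j - l)) *
        ∫ t in Ioi (0 : ℝ), D (ofComplex ((x : ℂ) + t * I)) * ((x : ℂ) + t * I) ^ l) := by ring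
  rw [hI, I_mul_I, neg_neg, one_mul]

/-- Integrability of the weighted cusp-ray integrand at a rational cusp. [folklore] -/
theorem integrableOn_cuspRay_weight (D : CuspForm (Gamma0 L) k) (x : ℚ) (c : ℝ) (j : ℕ) :
    IntegrableOn (fun t : ℝ ↦ D (ofComplex ((x : ℂ) + t * I)) * ((c : ℂ) * t * I) ^ j) (Ioi 0) := by
  have h : IntegrableOn (fun t : ℝ ↦ ((c : ℂ) * I) ^ j * (D (ofComplex ((x : ℂ) + t * I)) * (t : ℂ) ^ j))
      (Ioi 0) := (integrableOn_cuspRay_mul_ofReal_pow D x j).const_mul _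
  refine h.congr_fun (fun t _ ↦ ?_) measurableSet_Ioi
  simp only [mul_pow]
  ring

/-- **`U_p` sums the weighted integrals over the `p` cusps above `x`**: for `p ∣ L` prime,
`D ∈ S_k(Γ₀(L))`, a rational `x` and a scale `c`,
`∑_{b mod p} ∫₀^∞ D((x − b)/p + it)(ipct)ʲ dt = ∫₀^∞ (U_p D)(x + is)(ics)ʲ ds` — the engine
`sum_integral_cuspRay_div_eq` (cusps `(x + b)/p`, reflected to `(x − b)/p` by `1`-periodicity,
`sum_fin_reflect_of_periodic`) with the weight `G(t) = (ipct)ʲ`, `G(s/p) = (ics)ʲ`. [cite: MazurTateTeitelbaum1986Invent, §I.10] -/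
theorem sum_integral_cuspRay_weight_heckeT {p : ℕ} (hp : p.Prime) (hpL : p ∣ L) (D : CuspForm (Gamma0 L) k)
    (x : ℚ) (c : ℝ) (j : ℕ) :
    ∑ b : Fin p, ∫ t in Ioi (0 : ℝ), D (ofComplex ((((x - b) / p : ℚ) : ℂ) + t * I)) *
        (((p * c : ℝ) : ℂ) * t * I) ^ j =
      ∫ s in Ioi (0 : ℝ), (haveI : NeZero p := ⟨hp.ne_zero⟩; heckeT (Gamma0 L) k p D)
        (ofComplex ((x : ℂ) + s * I)) * ((c : ℂ) * s * I) ^ j := by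
  haveI : NeZero p := ⟨hp.ne_zero⟩
  have hp0 : (p : ℂ) ≠ 0 := by exact_mod_cast hp.ne_zero
  -- reflect `b ↦ -b` using periodicity
  have hper : ∀ y : ℚ, (∫ t in Ioi (0 : ℝ), D (ofComplex (((y + 1 : ℚ) : ℂ) + t * I)) *
      (((p * c : ℝ) : ℂ) * t * I) ^ j) =
      ∫ t in Ioi (0 : ℝ), D (ofComplex ((y : ℂ) + t * I)) * (((p * c : ℝ) : ℂ) * t * I) ^ j := by
    intro y
    refine setIntegral_congr_fun measurableSet_Ioi fun t _ ↦ ?_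
    have h := (isCuspFunction_one D).periodic ((y : ℂ) + t * I)
    simp only [Function.comp_apply] at h
    have e : ((y + 1 : ℚ) : ℂ) + t * I = (y : ℂ) + t * I + ((1 : ℝ) : ℂ) := by push_cast; ring
    rw [e, h]
  rw [sum_fin_reflect_of_periodic p (fun y : ℚ ↦ ∫ t in Ioi (0 : ℝ), D (ofComplex ((y : ℂ) + t * I)) *
    (((p * c : ℝ) : ℂ) * t * I) ^ j) hper x]
  -- the engine
  have hcast : ∀ b : Fin p, (((x + (b : ℕ)) / p : ℚ) : ℂ) = ((((x : ℝ) + (b : ℕ)) / p : ℝ) : ℂ) := by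
    intro b; push_cast; ring
  have h := sum_integral_cuspRay_div_eq hp hpL D (x : ℝ) (fun t ↦ (((p * c : ℝ) : ℂ) * t * I) ^ j)
    (fun b ↦ by
      have := integrableOn_cuspRay_weight D ((x + (b : ℕ)) / p) (p * c) j
      simpa only [hcast] using this)
  have hlhs : ∀ b : Fin p, (∫ t in Ioi (0 : ℝ), D (ofComplex ((((x + b) / p : ℚ) : ℂ) + t * I)) *
      (((p * c : ℝ) : ℂ) * t * I) ^ j) =
      ∫ t in Ioi (0 : ℝ), D (ofComplex (((((x : ℝ) + b) / p : ℝ) : ℂ) + t * I)) *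
        (((p * c : ℝ) : ℂ) * t * I) ^ j := by
    intro b
    rw [show ((b : Fin p) : ℚ) = ((b : ℕ) : ℚ) from rfl, hcast b]
  simp_rw [hlhs]
  rw [h, ofReal_ratCast]
  refine setIntegral_congr_fun measurableSet_Ioi fun s _ ↦ ?_
  congr 2
  push_cast
  field_simp

end Complex

/-! ### The two old forms `ι₁ g`, `ι_p g` at level `N p` and their `U_p`-relations -/

section Stabilisation

variable {N : ℕ} [NeZero N] {p : ℕ} [Fact p.Prime] {k : ℤ}

/-- **`U_p ι_p g = ι₁ g` on the weighted integrals**: for `g ∈ S_k(Γ₀(N))`, `p ∤ N` not needed,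
`∑_{b mod p} ∫₀^∞ (ι_p g)((x − b)/p + it)(ipct)ʲ dt = ∫₀^∞ (ι₁ g)(x + is)(ics)ʲ ds`
(`heckeT_iota_mul`: `U_p ι_p = ι₁`). [cite: MazurTateTeitelbaum1986Invent, §I.10] -/
theorem sum_integral_cuspRay_weight_iota_p (g : CuspForm (Gamma0 N) k) (x : ℚ) (c : ℝ) (j : ℕ) :
    ∑ b : Fin p, ∫ t in Ioi (0 : ℝ), iota N (N * p) p k dvd_rfl g
        (ofComplex ((((x - b) / p : ℚ) : ℂ) + t * I)) * (((p * c : ℝ) : ℂ) * t * I) ^ j =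
      ∫ s in Ioi (0 : ℝ), iota N (N * p) 1 k (mul_dvd_mul_left N (one_dvd p)) g
        (ofComplex ((x : ℂ) + s * I)) * ((c : ℂ) * s * I) ^ j := by
  have hp : p.Prime := Fact.out
  rw [sum_integral_cuspRay_weight_heckeT hp (dvd_mul_left p N) _ x c j]
  have hp1' : N * (p * 1) ∣ N * p := by rw [mul_one]
  have hUp : heckeT (Gamma0 (N * p)) k p (iota N (N * p) p k dvd_rfl g) =
      iota N (N * p) 1 k (mul_dvd_mul_left N (one_dvd p)) g := by
    rw [iota_congr (mul_one p).symm dvd_rfl hp1' g]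
    exact heckeT_iota_mul hp1' (mul_dvd_mul_left N (one_dvd p)) hp (dvd_mul_left p N) g
  rw [hUp]

/-- **`U_p ι₁ g = a_p ι₁ g − p^{k−1} ι_p g` on the weighted integrals** (`p ∤ N`, `T_p g = a_p g`):
`∑_{b mod p} ∫₀^∞ (ι₁ g)((x − b)/p + it)(ipct)ʲ dt
  = a_p ∫₀^∞ (ι₁ g)(x + is)(ics)ʲ ds − p^{k−1} ∫₀^∞ (ι_p g)(x + is)(ics)ʲ ds`
(`heckeT_iota_of_dvd_of_not_dvd`). [cite: MazurTateTeitelbaum1986Invent, §I.10] -/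
theorem sum_integral_cuspRay_weight_iota_one (hpN : ¬ p ∣ N) (g : CuspForm (Gamma0 N) k) {ap : ℂ}
    (hT : heckeT (Gamma0 N) k p g = ap • g) (x : ℚ) (c : ℝ) (j : ℕ) :
    ∑ b : Fin p, ∫ t in Ioi (0 : ℝ), iota N (N * p) 1 k (mul_dvd_mul_left N (one_dvd p)) g
        (ofComplex ((((x - b) / p : ℚ) : ℂ) + t * I)) * (((p * c : ℝ) : ℂ) * t * I) ^ j =
      ap * (∫ s in Ioi (0 : ℝ), iota N (N * p) 1 k (mul_dvd_mul_left N (one_dvd p)) g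
          (ofComplex ((x : ℂ) + s * I)) * ((c : ℂ) * s * I) ^ j) -
        (p : ℂ) ^ (k - 1) * ∫ s in Ioi (0 : ℝ), iota N (N * p) p k dvd_rfl g
          (ofComplex ((x : ℂ) + s * I)) * ((c : ℂ) * s * I) ^ j := by
  have hp : p.Prime := Fact.out
  rw [sum_integral_cuspRay_weight_heckeT hp (dvd_mul_left p N) _ x c j]
  have hp1 : N * (1 * p) ∣ N * p := by rw [one_mul]
  have hU1 : heckeT (Gamma0 (N * p)) k p (iota N (N * p) 1 k (mul_dvd_mul_left N (one_dvd p)) g) =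
      ap • iota N (N * p) 1 k (mul_dvd_mul_left N (one_dvd p)) g -
        (p : ℂ) ^ (k - 1) • iota N (N * p) p k dvd_rfl g := by
    rw [heckeT_iota_of_dvd_of_not_dvd (mul_dvd_mul_left N (one_dvd p)) hp1 hp (dvd_mul_left p N) hpN
      hp.not_dvd_one, hT, map_smul, iota_congr (one_mul p) hp1 dvd_rfl g]
  rw [hU1, ← integral_const_mul, ← integral_const_mul,
    ← integral_sub ((integrableOn_cuspRay_weight _ x c j).const_mul _)
      ((integrableOn_cuspRay_weight _ x c j).const_mul _)]
  refine setIntegral_congr_fun measurableSet_Ioi fun s _ ↦ ?_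
  simp only [CuspForm.sub_apply, CuspForm.IsGLPos.smul_apply, smul_eq_mul]
  ring

end Stabilisation

/-! ### The weighted sums of ray moments `W_j(D; c, x) = ∑ₗ C(j,l) cˡ (−cx)^{j−l} ∫ₓ^{i∞} D zˡ dz` -/

section Wsum

variable {L : ℕ} [NeZero L] {k : ℤ}

/-- **The binomially weighted sum of cusp ray moments**
`Wsum D j c x = ∑_{l ≤ j} C(j,l) cˡ (−cx)^{j−l} ∫ₓ^{i∞} D(z) zˡ dz = ∫ₓ^{i∞} D(z)(cz − cx)ʲ dz`, so that
`∫₀^∞ D(x + it)(ict)ʲ dt = −i · Wsum D j c x` (`integral_cuspRay_weight_eq_Wsum`); at `x = −a/pᵐ`,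
`c = pᵐ` the polynomial is `(pᵐ z + a)ʲ`, the weight of the `j`-th moment over the ball
`a + pᵐℤ_p` in the Mazur–Tate–Teitelbaum measure (Mazur–Tate–Teitelbaum 1986, §I.10; Bellaïche,
*The Eigenbook*, §6.7.3).  The coefficients are kept rational. [cite: MazurTateTeitelbaum1986Invent, §I.10] -/
def Wsum (D : CuspForm (Gamma0 L) k) (j : ℕ) (c x : ℚ) : ℂ :=
  ∑ l ∈ Finset.range (j + 1), (((j.choose l : ℚ) * c ^ l * (-(c * x)) ^ (j - l) : ℚ) : ℂ) * rayMoment ⇑D l x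

omit [NeZero L] in
/-- Unfolding lemma. [folklore] -/
theorem Wsum_def (D : CuspForm (Gamma0 L) k) (j : ℕ) (c x : ℚ) :
    Wsum D j c x = ∑ l ∈ Finset.range (j + 1),
      (((j.choose l : ℚ) * c ^ l * (-(c * x)) ^ (j - l) : ℚ) : ℂ) * rayMoment ⇑D l x := rfl

/-- **`∫₀^∞ D(x + it)(ict)ʲ dt = −i · Wsum D j c x`** (rational `x`, `c`). [folklore] -/
theorem integral_cuspRay_weight_eq_Wsum (D : CuspForm (Gamma0 L) k) (x c : ℚ) (j : ℕ) :
    ∫ t in Ioi (0 : ℝ), D (ofComplex ((x : ℂ) + t * I)) * (((c : ℝ) : ℂ) * t * I) ^ j =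
      -I * Wsum D j c x := by
  rw [integral_cuspRay_weight_eq_sum_rayMoment D x (c : ℝ) j, Wsum_def]
  congr 1
  refine Finset.sum_congr rfl fun l _ ↦ ?_
  push_cast
  ring

omit [NeZero L] in
/-- At `x = 0` only the top moment survives: `Wsum D j c 0 = cʲ ∫_0^{i∞} D(z) zʲ dz`. [folklore] -/
theorem Wsum_zero_right (D : CuspForm (Gamma0 L) k) (j : ℕ) (c : ℚ) :
    Wsum D j c 0 = ((c ^ j : ℚ) : ℂ) * rayMoment ⇑D j 0 := by
  rw [Wsum_def, Finset.sum_eq_single j (fun l hl hlj ↦ ?_) (fun h ↦ ?_)]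
  · simp
  · have : j - l ≠ 0 := by
      have := Finset.mem_range.mp hl
      omega
    simp [zero_pow this]
  · exact absurd (Finset.self_mem_range_succ j) h

variable {N : ℕ} [NeZero N] {p : ℕ} [Fact p.Prime]

/-- **`U_p ι_p g = ι₁ g` on the weighted sums**: with the `p` cusps `(x − t)/p` above `x` and the
scale multiplied by `p`, `∑_{t mod p} Wsum (ι_p g) j (pc) ((x − t)/p) = Wsum (ι₁ g) j c x`. [cite: MazurTateTeitelbaum1986Invent, §I.10] -/
theorem sum_Wsum_iota_p (g : CuspForm (Gamma0 N) k) (j : ℕ) (c x : ℚ) :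
    ∑ t : Fin p, Wsum (iota N (N * p) p k dvd_rfl g) j (p * c) ((x - t) / p) =
      Wsum (iota N (N * p) 1 k (mul_dvd_mul_left N (one_dvd p)) g) j c x := by
  have hI : (-I : ℂ) ≠ 0 := neg_ne_zero.mpr I_ne_zero
  apply mul_left_cancel₀ hI
  rw [Finset.mul_sum]
  simp_rw [← integral_cuspRay_weight_eq_Wsum]
  have h := sum_integral_cuspRay_weight_iota_p (p := p) g x (c : ℝ) j
  push_cast at h ⊢
  exact h

/-- **`U_p ι₁ g = a_p ι₁ g − p^{k−1} ι_p g` on the weighted sums** (`p ∤ N`, `T_p g = a_p g`):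
`∑_{t mod p} Wsum (ι₁ g) j (pc) ((x − t)/p) = a_p Wsum (ι₁ g) j c x − p^{k−1} Wsum (ι_p g) j c x`. [cite: MazurTateTeitelbaum1986Invent, §I.10] -/
theorem sum_Wsum_iota_one (hpN : ¬ p ∣ N) (g : CuspForm (Gamma0 N) k) {ap : ℂ}
    (hT : heckeT (Gamma0 N) k p g = ap • g) (j : ℕ) (c x : ℚ) :
    ∑ t : Fin p, Wsum (iota N (N * p) 1 k (mul_dvd_mul_left N (one_dvd p)) g) j (p * c) ((x - t) / p) =
      ap * Wsum (iota N (N * p) 1 k (mul_dvd_mul_left N (one_dvd p)) g) j c x -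
        (p : ℂ) ^ (k - 1) * Wsum (iota N (N * p) p k dvd_rfl g) j c x := by
  have hI : (-I : ℂ) ≠ 0 := neg_ne_zero.mpr I_ne_zero
  apply mul_left_cancel₀ hI
  rw [Finset.mul_sum, show -I * (ap * Wsum (iota N (N * p) 1 k (mul_dvd_mul_left N (one_dvd p)) g) j c x -
      (p : ℂ) ^ (k - 1) * Wsum (iota N (N * p) p k dvd_rfl g) j c x) =
      ap * (-I * Wsum (iota N (N * p) 1 k (mul_dvd_mul_left N (one_dvd p)) g) j c x) -
        (p : ℂ) ^ (k - 1) * (-I * Wsum (iota N (N * p) p k dvd_rfl g) j c x) by ring]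
  simp_rw [← integral_cuspRay_weight_eq_Wsum]
  have h := sum_integral_cuspRay_weight_iota_one (p := p) hpN g hT x (c : ℝ) j
  push_cast at h ⊢
  exact h

end Wsum

/-! ### The `Ω i`-coordinate functional `z ↦ ι(Im z / Ω)` with values in `ℚ_p` -/

section Functional

variable {p : ℕ} [Fact p.Prime] (K' : IntermediateField ℚ ℂ) (ι : K' →+* ℚ_[p]) (Ω : ℝ)

/-- **The complex numbers with `K'`-rational `Ω i`-coordinate**: `{z : Im z / Ω ∈ K'}`, a
`ℚ`-subspace of `ℂ` (for the period `Ω = Ω⁻_f` of a newform `f` with `K_f ≤ K'` it contains the whole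
`K_f`-plane `K_f Ω⁺ ⊕ K_f Ω⁻ i` of cuspidal period values, `span_cuspidal_le_imCoordSubmodule`). [folklore] -/
def imCoordSubmodule : Submodule ℚ ℂ where
  carrier := {z | (((z.im / Ω : ℝ)) : ℂ) ∈ K'}
  zero_mem' := by simp
  add_mem' {z w} hz hw := by
    simp only [Set.mem_setOf_eq, add_im, add_div, ofReal_add] at hz hw ⊢
    exact add_mem hz hw
  smul_mem' q z hz := by
    simp only [Set.mem_setOf_eq] at hz ⊢
    have e : (((q • z).im / Ω : ℝ) : ℂ) = (q : ℂ) * (((z.im / Ω : ℝ)) : ℂ) := by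
      rw [Rat.smul_def, ← ofReal_ratCast, im_ofReal_mul]
      push_cast
      ring
    rw [e]
    exact mul_mem (SubfieldClass.ratCast_mem K' q) hz

variable {K' Ω} in
/-- Membership in `imCoordSubmodule`. [folklore] -/
theorem mem_imCoordSubmodule {z : ℂ} :
    z ∈ imCoordSubmodule K' Ω ↔ (((z.im / Ω : ℝ)) : ℂ) ∈ K' := Iff.rfl

/-- **The functional `λ(z) = ι(Im z / Ω) ∈ ℚ_p`** (and `0` off `imCoordSubmodule K' Ω`): the
`p`-adic realisation, through `ι : K' → ℚ_p`, of the `Ω i`-coordinate of a period value — the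
"minus part divided by the period" of Mazur–Tate–Teitelbaum 1986, §I.10 (formula for `μ⁻_{f,α}`),
for `Ω = Ω⁻_f`. [cite: MazurTateTeitelbaum1986Invent, §I.10] -/
def imCoordPadic (z : ℂ) : ℚ_[p] :=
  haveI := Classical.propDecidable ((((z.im / Ω : ℝ)) : ℂ) ∈ K')
  if h : (((z.im / Ω : ℝ)) : ℂ) ∈ K' then ι ⟨_, h⟩ else 0

variable {K' ι Ω}

/-- Value on the subspace. [folklore] -/
theorem imCoordPadic_of_mem {z : ℂ} (h : (((z.im / Ω : ℝ)) : ℂ) ∈ K') :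
    imCoordPadic K' ι Ω z = ι ⟨_, h⟩ := dif_pos h

/-- `λ(0) = 0`. [folklore] -/
@[simp] theorem imCoordPadic_zero : imCoordPadic K' ι Ω 0 = 0 := by
  rw [imCoordPadic_of_mem (by simp)]
  have : (⟨(((0 : ℂ).im / Ω : ℝ) : ℂ), by simp⟩ : K') = 0 := Subtype.ext (by simp)
  rw [this, map_zero]

/-- **Additivity on the subspace.** [folklore] -/
theorem imCoordPadic_add {z w : ℂ} (hz : z ∈ imCoordSubmodule K' Ω) (hw : w ∈ imCoordSubmodule K' Ω) :
    imCoordPadic K' ι Ω (z + w) = imCoordPadic K' ι Ω z + imCoordPadic K' ι Ω w := by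
  rw [imCoordPadic_of_mem hz, imCoordPadic_of_mem hw, imCoordPadic_of_mem (add_mem hz hw), ← map_add]
  congr 1
  apply Subtype.ext
  simp only [add_im, AddMemClass.coe_add]
  push_cast
  ring

/-- **`λ(a z) = ι(a) λ(z)` for REAL `a ∈ K'`** (e.g. `a ∈ K_f`, `a = a_p(f)`). [folklore] -/
theorem imCoordPadic_mul_of_im_eq_zero {a z : ℂ} (ha : a ∈ K') (ha0 : a.im = 0)
    (hz : z ∈ imCoordSubmodule K' Ω) :
    imCoordPadic K' ι Ω (a * z) = ι ⟨a, ha⟩ * imCoordPadic K' ι Ω z := by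
  have haz : (((a * z).im / Ω : ℝ) : ℂ) = a * (((z.im / Ω : ℝ)) : ℂ) := by
    have ha' : a = ((a.re : ℝ) : ℂ) := Complex.ext (by simp) (by simp [ha0])
    rw [mul_im, ha0, zero_mul, add_zero]
    conv_rhs => rw [ha']
    push_cast
    ring
  have hmem : (((a * z).im / Ω : ℝ) : ℂ) ∈ K' := by rw [haz]; exact mul_mem ha hz
  rw [imCoordPadic_of_mem hz, imCoordPadic_of_mem hmem, ← map_mul]
  congr 1
  exact Subtype.ext haz

/-- **`λ(q z) = q λ(z)` for rational `q`.** [folklore] -/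
theorem imCoordPadic_ratCast_mul (q : ℚ) {z : ℂ} (hz : z ∈ imCoordSubmodule K' Ω) :
    imCoordPadic K' ι Ω ((q : ℂ) * z) = (q : ℚ_[p]) * imCoordPadic K' ι Ω z := by
  rw [imCoordPadic_mul_of_im_eq_zero (SubfieldClass.ratCast_mem K' q) (by simp) hz]
  congr 1
  have : (⟨(q : ℂ), SubfieldClass.ratCast_mem K' q⟩ : K') = (q : K') :=
    Subtype.ext (by simp)
  rw [this, map_ratCast]

/-- **`λ(z − w) = λ(z) − λ(w)` on the subspace.** [folklore] -/
theorem imCoordPadic_sub {z w : ℂ} (hz : z ∈ imCoordSubmodule K' Ω) (hw : w ∈ imCoordSubmodule K' Ω) :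
    imCoordPadic K' ι Ω (z - w) = imCoordPadic K' ι Ω z - imCoordPadic K' ι Ω w := by
  have hw' : (((-1 : ℚ) : ℂ)) * w ∈ imCoordSubmodule K' Ω := by
    have := (imCoordSubmodule K' Ω).smul_mem (-1 : ℚ) hw
    rwa [Rat.smul_def] at this
  rw [sub_eq_add_neg, show -w = ((-1 : ℚ) : ℂ) * w by push_cast; ring, imCoordPadic_add hz hw',
    imCoordPadic_ratCast_mul _ hw]
  push_cast
  ring

/-- **`λ` through rational combinations**: `λ(∑ᵢ qᵢ zᵢ) = ∑ᵢ qᵢ λ(zᵢ)` for `zᵢ` in the subspace. [folklore] -/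
theorem imCoordPadic_sum_ratCast_mul {α : Type*} (s : Finset α) (q : α → ℚ) (z : α → ℂ)
    (hz : ∀ i ∈ s, z i ∈ imCoordSubmodule K' Ω) :
    imCoordPadic K' ι Ω (∑ i ∈ s, (q i : ℂ) * z i) = ∑ i ∈ s, (q i : ℚ_[p]) * imCoordPadic K' ι Ω (z i) := by
  classical
  induction s using Finset.induction_on with
  | empty => simp
  | insert a s has ih =>
    rw [Finset.sum_insert has, Finset.sum_insert has,
      imCoordPadic_add ?_ (Submodule.sum_mem _ fun i hi ↦ ?_),
      imCoordPadic_ratCast_mul _ (hz a (Finset.mem_insert_self a s)),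
      ih fun i hi ↦ hz i (Finset.mem_insert_of_mem hi)]
    · have := (imCoordSubmodule K' Ω).smul_mem (q a) (hz a (Finset.mem_insert_self a s))
      rwa [Rat.smul_def] at this
    · have := (imCoordSubmodule K' Ω).smul_mem (q i) (hz i (Finset.mem_insert_of_mem hi))
      rwa [Rat.smul_def] at this

/-- **`λ` over a finite sum.** [folklore] -/
theorem imCoordPadic_sum {α : Type*} (s : Finset α) (z : α → ℂ)
    (hz : ∀ i ∈ s, z i ∈ imCoordSubmodule K' Ω) :
    imCoordPadic K' ι Ω (∑ i ∈ s, z i) = ∑ i ∈ s, imCoordPadic K' ι Ω (z i) := by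
  have h := imCoordPadic_sum_ratCast_mul (ι := ι) s (fun _ ↦ (1 : ℚ)) z hz
  simpa using h

/-- **Boundedness on a finitely generated subgroup**: if `M = ℤ⟨G⟩` (`G` finite) lies in the
subspace, then `‖λ(m)‖ ≤ B` for all `m ∈ M`, `B = max_{g ∈ G} ‖λ(g)‖` — `λ` is additive on `M` and
`ℚ_p` is ultrametric ("bounded denominators ⇒ bounded measure", Mazur–Tate–Teitelbaum 1986, §I.10;
Manin 1973, Thm. 1.3). [cite: MazurTateTeitelbaum1986Invent, §I.10] -/
theorem exists_norm_imCoordPadic_le_of_fg {M : Submodule ℤ ℂ} (hM : M.FG)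
    (hMV : ∀ z ∈ M, z ∈ imCoordSubmodule K' Ω) :
    ∃ B : ℝ, 0 ≤ B ∧ ∀ z ∈ M, ‖imCoordPadic K' ι Ω z‖ ≤ B := by
  classical
  obtain ⟨G, hG⟩ := hM
  refine ⟨∑ g ∈ G, ‖imCoordPadic K' ι Ω g‖, Finset.sum_nonneg fun _ _ ↦ norm_nonneg _,
    fun z hz ↦ ?_⟩
  have hMV' : ∀ x ∈ Submodule.span ℤ (G : Set ℂ), x ∈ imCoordSubmodule K' Ω :=
    fun x hx ↦ hMV x (hG ▸ hx)
  rw [← hG] at hz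
  refine Submodule.span_induction
    (p := fun z _ ↦ ‖imCoordPadic K' ι Ω z‖ ≤ ∑ g ∈ G, ‖imCoordPadic K' ι Ω g‖) ?_ ?_ ?_ ?_ hz
  · intro g hg
    exact Finset.single_le_sum (f := fun g ↦ ‖imCoordPadic K' ι Ω g‖) (fun _ _ ↦ norm_nonneg _) hg
  · simpa using Finset.sum_nonneg fun g (_ : g ∈ G) ↦ norm_nonneg (imCoordPadic K' ι Ω g)
  · intro x y hx hy hxB hyB
    rw [imCoordPadic_add (hMV' x hx) (hMV' y hy)]
    exact (IsUltrametricDist.norm_add_le_max _ _).trans (max_le hxB hyB)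
  · intro a x hx hxB
    rw [zsmul_eq_mul, ← Rat.cast_intCast, imCoordPadic_ratCast_mul _ (hMV' x hx), norm_mul,
      Rat.cast_intCast]
    calc _ ≤ 1 * ∑ g ∈ G, ‖imCoordPadic K' ι Ω g‖ :=
          mul_le_mul (Padic.norm_int_le_one a) hxB (norm_nonneg _) zero_le_one
      _ = _ := one_mul _

end Functional

/-! ### The `p`-adic moment distributions of the `p`-stabilised newform -/

section Distributions

variable {N : ℕ} [NeZero N] (p : ℕ) [Fact p.Prime] {n : ℕ}

omit [NeZero N] in
/-- The cusps `z/pᵐ` have denominator prime to `N` when `p ∤ N`. [folklore] -/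
theorem isCoprime_den_div_pow (hpN : ¬ p ∣ N) (z : ℤ) (m : ℕ) :
    IsCoprime ((((z : ℚ) / (p : ℚ) ^ m).den : ℤ)) (N : ℤ) := by
  have hp : p.Prime := Fact.out
  have hden : ((((z : ℚ) / (p : ℚ) ^ m).den : ℤ)) ∣ (p : ℤ) ^ m := by
    have h := Rat.den_dvd z ((p : ℤ) ^ m)
    rwa [Rat.divInt_eq_div, Int.cast_pow, Int.cast_natCast] at h
  have hcop : IsCoprime ((p : ℤ) ^ m) (N : ℤ) :=
    (Nat.isCoprime_iff_coprime.mpr ((Nat.Prime.coprime_iff_not_dvd hp).mpr hpN)).pow_left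
  exact hcop.of_isCoprime_of_dvd_left hden

variable (g : CuspForm (Gamma0 N) (n + 2)) (K' : IntermediateField ℚ ℂ) (ι : K' →+* ℚ_[p]) (Ω : ℝ)
  (υ cι : ℚ_[p])

/-- **The `j`-th moment distribution of the `p`-stabilised newform, minus part, `p`-adically**:
for `g ∈ S_{n+2}(Γ₀(N))`, `F = ι₁ g − (a_p − u) ι_p g` its `p`-stabilisation with `U_p F = uF`, the
period `Ω = Ω⁻_g`, an embedding `ι : K' → ℚ_p` of a field containing `K_g` and `u`, `υ = ι(u)` and
`cι = ι(a_p − u)`: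
`ν_j(a + pᵐℤ_p) = υ^{−m} · [λ(W_j(ι₁ g; pᵐ, −a/pᵐ)) − cι · λ(W_j(ι_p g; pᵐ, −a/pᵐ))]`, i.e. `ι` of the
`Ω i`-coordinate of `u^{−m} ∫_{−a/pᵐ}^{i∞} F(z)(pᵐ z + a)ʲ dz = "∫_{a + pᵐℤ_p} xʲ dμ_{F,u}"`, the
stabilisation being formed AFTER projecting the periods of `g` (Mazur–Tate–Teitelbaum 1986, §I.10,
the measures `μ^±_{f,α}`; Bellaïche, *The Eigenbook*, §6.7.3; Delbourgo 2008, Thm. 2.2).  The ball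
`a + pᵐℤ_p` corresponds to the cusp `−a/pᵐ`. [cite: MazurTateTeitelbaum1986Invent, §I.10] -/
def mttNu (j m : ℕ) (a : ZMod (p ^ m)) : ℚ_[p] :=
  (υ⁻¹) ^ m *
    (imCoordPadic K' ι Ω (Wsum (iota N (N * p) 1 (n + 2) (mul_dvd_mul_left N (one_dvd p)) g) j
        ((p : ℚ) ^ m) (((-(a.val : ℤ) : ℤ) : ℚ) / (p : ℚ) ^ m)) -
      cι * imCoordPadic K' ι Ω (Wsum (iota N (N * p) p (n + 2) dvd_rfl g) j
        ((p : ℚ) ^ m) (((-(a.val : ℤ) : ℤ) : ℚ) / (p : ℚ) ^ m)))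

variable {p g K' ι Ω υ cι}

omit [NeZero N] in
/-- Unfolding lemma. [folklore] -/
theorem mttNu_def (j m : ℕ) (a : ZMod (p ^ m)) :
    mttNu p g K' ι Ω υ cι j m a = (υ⁻¹) ^ m *
      (imCoordPadic K' ι Ω (Wsum (iota N (N * p) 1 (n + 2) (mul_dvd_mul_left N (one_dvd p)) g) j
          ((p : ℚ) ^ m) (((-(a.val : ℤ) : ℤ) : ℚ) / (p : ℚ) ^ m)) -
        cι * imCoordPadic K' ι Ω (Wsum (iota N (N * p) p (n + 2) dvd_rfl g) j
          ((p : ℚ) ^ m) (((-(a.val : ℤ) : ℤ) : ℚ) / (p : ℚ) ^ m))) := rfl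

omit [Fact p.Prime] in
/-- The ray moments of `ι₁ g` are those of `g`. [folklore] -/
theorem rayMoment_iota_one (l : ℕ) (x : ℝ) :
    rayMoment ⇑(iota N (N * p) 1 (n + 2) (mul_dvd_mul_left N (one_dvd p)) g) l x = rayMoment ⇑g l x := by
  rw [rayMoment_iota]; simp

/-- The ray moments of `ι_p g`: `p^{−(l+1)} ∫_{px}^{i∞} g zˡ dz`. [folklore] -/
theorem rayMoment_iota_p (l : ℕ) (x : ℝ) :
    rayMoment ⇑(iota N (N * p) p (n + 2) dvd_rfl g) l x =
      ((((p : ℚ) ^ (l + 1))⁻¹ : ℚ) : ℂ) * rayMoment ⇑g l (p * x) := by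
  rw [rayMoment_iota]; push_cast; rfl

/-- **The two values entering `L(γʲ − 1)`**: `ν_j(ℤ_p) − ν_j(pℤ_p) = (1 − pʲ/υ)(1 − cι/p^{j+1}) λ(∫_0^{i∞} g zʲ dz)`
(the balls `ℤ_p` and `pℤ_p` both sit over the cusp `0`; `Wsum_zero_right`). [cite: MazurTateTeitelbaum1986Invent, §I.14] -/
theorem mttNu_zero_sub_mttNu_one (j : ℕ) (h0 : rayMoment ⇑g j 0 ∈ imCoordSubmodule K' Ω) :
    mttNu p g K' ι Ω υ cι j 0 0 - mttNu p g K' ι Ω υ cι j 1 0 =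
      (1 - (p : ℚ_[p]) ^ j * υ⁻¹) * (1 - cι * ((p : ℚ_[p]) ^ (j + 1))⁻¹) *
        imCoordPadic K' ι Ω (rayMoment ⇑g j 0) := by
  have hp : p.Prime := Fact.out
  have e0 : ∀ m : ℕ, (((-((0 : ZMod (p ^ m)).val : ℤ) : ℤ) : ℚ) / (p : ℚ) ^ m) = 0 := fun m ↦ by
    rw [ZMod.val_zero]; simp
  have h1 : ∀ c : ℚ, imCoordPadic K' ι Ω (Wsum (iota N (N * p) 1 (n + 2) (mul_dvd_mul_left N (one_dvd p)) g)
      j c 0) = (c : ℚ_[p]) ^ j * imCoordPadic K' ι Ω (rayMoment ⇑g j 0) := by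
    intro c
    rw [Wsum_zero_right, rayMoment_iota_one, imCoordPadic_ratCast_mul _ h0]
    push_cast; rfl
  have hp' : ∀ c : ℚ, imCoordPadic K' ι Ω (Wsum (iota N (N * p) p (n + 2) dvd_rfl g) j c 0) =
      (c : ℚ_[p]) ^ j * ((p : ℚ_[p]) ^ (j + 1))⁻¹ * imCoordPadic K' ι Ω (rayMoment ⇑g j 0) := by
    intro c
    rw [Wsum_zero_right, rayMoment_iota_p, mul_zero, ← mul_assoc, ← Rat.cast_mul,
      imCoordPadic_ratCast_mul _ h0]
    push_cast; ring
  rw [mttNu_def, mttNu_def, e0, e0, h1, h1, hp', hp']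
  push_cast
  ring

omit [Fact p.Prime] in
/-- **The weighted sums of `ι₁ g` lie in the subspace** when all ray moments `∫_r^{i∞} g zˡ dz`,
`l ≤ n`, at cusps `r` with `gcd(den r, N) = 1` do (`j ≤ n`). [folklore] -/
theorem Wsum_iota_one_mem
    (hV : ∀ l ≤ n, ∀ r : ℚ, IsCoprime (r.den : ℤ) (N : ℤ) → rayMoment ⇑g l r ∈ imCoordSubmodule K' Ω)
    {j : ℕ} (hj : j ≤ n) (c r : ℚ) (hr : IsCoprime (r.den : ℤ) (N : ℤ)) :
    Wsum (iota N (N * p) 1 (n + 2) (mul_dvd_mul_left N (one_dvd p)) g) j c r ∈ imCoordSubmodule K' Ω := by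
  rw [Wsum_def]
  refine Submodule.sum_mem _ fun l hl ↦ ?_
  have hl' : l ≤ n := (Nat.lt_succ_iff.mp (Finset.mem_range.mp hl)).trans hj
  rw [rayMoment_iota_one, ← Rat.smul_def]
  exact Submodule.smul_mem _ _ (hV l hl' r hr)

/-- **The weighted sums of `ι_p g` lie in the subspace** (the moments of `ι_p g` at `r` are those of
`g` at `pr`, `rayMoment_iota_p`). [folklore] -/
theorem Wsum_iota_p_mem
    (hV : ∀ l ≤ n, ∀ r : ℚ, IsCoprime (r.den : ℤ) (N : ℤ) → rayMoment ⇑g l r ∈ imCoordSubmodule K' Ω)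
    {j : ℕ} (hj : j ≤ n) (c r : ℚ) (hr : IsCoprime (((p : ℚ) * r).den : ℤ) (N : ℤ)) :
    Wsum (iota N (N * p) p (n + 2) dvd_rfl g) j c r ∈ imCoordSubmodule K' Ω := by
  rw [Wsum_def]
  refine Submodule.sum_mem _ fun l hl ↦ ?_
  have hl' : l ≤ n := (Nat.lt_succ_iff.mp (Finset.mem_range.mp hl)).trans hj
  rw [rayMoment_iota_p, ← mul_assoc, ← Rat.cast_mul, ← Rat.smul_def,
    show (p : ℝ) * (r : ℝ) = (((p : ℚ) * r : ℚ) : ℝ) by push_cast; ring]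
  exact Submodule.smul_mem _ _ (hV l hl' _ hr)

/-- **`λ` of the weighted sum of `ι₁ g`, expanded**:
`λ(W_j(ι₁ g; c, r)) = ∑ₗ C(j,l) cˡ (−cr)^{j−l} λ(∫_r^{i∞} g zˡ dz)`. [folklore] -/
theorem imCoordPadic_Wsum_iota_one
    (hV : ∀ l ≤ n, ∀ r : ℚ, IsCoprime (r.den : ℤ) (N : ℤ) → rayMoment ⇑g l r ∈ imCoordSubmodule K' Ω)
    {j : ℕ} (hj : j ≤ n) (c r : ℚ) (hr : IsCoprime (r.den : ℤ) (N : ℤ)) :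
    imCoordPadic K' ι Ω (Wsum (iota N (N * p) 1 (n + 2) (mul_dvd_mul_left N (one_dvd p)) g) j c r) =
      ∑ l ∈ Finset.range (j + 1), (((j.choose l : ℚ) * c ^ l * (-(c * r)) ^ (j - l) : ℚ) : ℚ_[p]) *
        imCoordPadic K' ι Ω (rayMoment ⇑g l r) := by
  rw [Wsum_def]
  simp_rw [rayMoment_iota_one]
  exact imCoordPadic_sum_ratCast_mul _ _ _ fun l hl ↦
    hV l ((Nat.lt_succ_iff.mp (Finset.mem_range.mp hl)).trans hj) r hr

/-- **`λ` of the weighted sum of `ι_p g`, expanded**: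
`λ(W_j(ι_p g; c, r)) = ∑ₗ C(j,l) cˡ (−cr)^{j−l} p^{−(l+1)} λ(∫_{pr}^{i∞} g zˡ dz)`. [folklore] -/
theorem imCoordPadic_Wsum_iota_p
    (hV : ∀ l ≤ n, ∀ r : ℚ, IsCoprime (r.den : ℤ) (N : ℤ) → rayMoment ⇑g l r ∈ imCoordSubmodule K' Ω)
    {j : ℕ} (hj : j ≤ n) (c r : ℚ) (hr : IsCoprime (((p : ℚ) * r).den : ℤ) (N : ℤ)) :
    imCoordPadic K' ι Ω (Wsum (iota N (N * p) p (n + 2) dvd_rfl g) j c r) =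
      ∑ l ∈ Finset.range (j + 1), (((j.choose l : ℚ) * c ^ l * (-(c * r)) ^ (j - l) *
        ((p : ℚ) ^ (l + 1))⁻¹ : ℚ) : ℚ_[p]) *
          imCoordPadic K' ι Ω (rayMoment ⇑g l ((((p : ℚ) * r : ℚ)) : ℝ)) := by
  rw [Wsum_def]
  simp_rw [rayMoment_iota_p, ← mul_assoc, ← Rat.cast_mul,
    show (p : ℝ) * (r : ℝ) = (((p : ℚ) * r : ℚ) : ℝ) by push_cast; ring]
  exact imCoordPadic_sum_ratCast_mul _ _ _ fun l hl ↦
    hV l ((Nat.lt_succ_iff.mp (Finset.mem_range.mp hl)).trans hj) _ hr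

/-- **The distribution relation of `ν_j`** (Mazur–Tate–Teitelbaum 1986, §I.10, Prop.; Delbourgo
2008, Thm. 2.2): for `p ∤ N`, a newform `g` (`T_p g = a_p g`, `a_p ∈ K_g ≤ K'` real), `υ, cι ∈ ℚ_p`
with `ι(a_p) − cι = υ` and `υ cι = p^{n+1}` (i.e. `υ = ι(u)`, `cι = ι(a_p − u)` for a root `u` of
`X² − a_p X + p^{n+1}`), and `j ≤ n`, `∑_{b ≡ a mod pᵐ} ν_j(b + p^{m+1}ℤ_p) = ν_j(a + pᵐℤ_p)`.
The `p` classes over `a` sit over the cusps `(x − t)/p`, `x = −a/pᵐ`; `U_p ι_p = ι₁` and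
`U_p ι₁ = a_p ι₁ − p^{n+1} ι_p` (`sum_Wsum_iota_p`, `sum_Wsum_iota_one`) are pushed through the
`ℚ`-linear functional `λ` (`a_p` real), and the relation reduces to `(ι(a_p) − cι) = υ`,
`p^{n+1} = υ cι`. [cite: MazurTateTeitelbaum1986Invent, §I.10] -/
theorem sum_fiber_mttNu (hpN : ¬ p ∣ N) (hg : IsNewform0 g) (hK : coeffField g ≤ K')
    (hV : ∀ l ≤ n, ∀ r : ℚ, IsCoprime (r.den : ℤ) (N : ℤ) → rayMoment ⇑g l r ∈ imCoordSubmodule K' Ω)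
    (hυ : ι ⟨(qExpansion 1 ⇑g).coeff p, hK (coeff_mem_coeffField g p)⟩ - cι = υ)
    (hυc : υ * cι = (p : ℚ_[p]) ^ (n + 1)) (hυ0 : υ ≠ 0)
    {j : ℕ} (hj : j ≤ n) (m : ℕ) (a : ZMod (p ^ m)) :
    ∑ b ∈ Finset.univ.filter (fun b : ZMod (p ^ (m + 1)) ↦
        ZMod.castHom (pow_dvd_pow p m.le_succ) (ZMod (p ^ m)) b = a),
      mttNu p g K' ι Ω υ cι j (m + 1) b = mttNu p g K' ι Ω υ cι j m a := by
  classical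
  have hp : p.Prime := Fact.out
  haveI : NeZero p := ⟨hp.ne_zero⟩
  have hp0 : (p : ℚ) ≠ 0 := by exact_mod_cast hp.ne_zero
  -- the fibre and its parametrisation
  have hinj : Function.Injective
      (fun t : Fin p ↦ ((a.val + p ^ m * (t : ℕ) : ℕ) : ZMod (p ^ (m + 1)))) := by
    intro t t' h
    have hv := congr_arg ZMod.val h
    simp only [val_classLift] at hv
    exact Fin.ext (Nat.eq_of_mul_eq_mul_left (pow_pos hp.pos m) (by omega))
  rw [filter_castHom_eq_image, Finset.sum_image fun t _ t' _ h ↦ hinj h]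
  -- the cusps
  set x : ℚ := ((-(a.val : ℤ) : ℤ) : ℚ) / (p : ℚ) ^ m with hxdef
  have hxt : ∀ t : Fin p,
      (((-((((a.val + p ^ m * (t : ℕ) : ℕ) : ZMod (p ^ (m + 1)))).val : ℤ) : ℤ) : ℚ) / (p : ℚ) ^ (m + 1))
        = (x - t) / p := by
    intro t
    rw [val_classLift, hxdef]
    push_cast
    field_simp
    ring
  have hcs : (p : ℚ) ^ (m + 1) = p * (p : ℚ) ^ m := by ring
  -- coprimality of the denominators
  have hx : IsCoprime (x.den : ℤ) (N : ℤ) := isCoprime_den_div_pow p hpN _ m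
  have hpx : IsCoprime (((p : ℚ) * x).den : ℤ) (N : ℤ) := by
    have e : (p : ℚ) * x = (((-(a.val : ℤ)) * p : ℤ) : ℚ) / (p : ℚ) ^ m := by
      rw [hxdef]; push_cast; ring
    rw [e]; exact isCoprime_den_div_pow p hpN _ m
  have hxt' : ∀ t : Fin p, IsCoprime (((x - t) / p : ℚ).den : ℤ) (N : ℤ) := by
    intro t
    have e : (x - t) / p = (((-(a.val : ℤ)) - (p : ℤ) ^ m * (t : ℕ) : ℤ) : ℚ) / (p : ℚ) ^ (m + 1) := by
      rw [hxdef]; push_cast; field_simp; ring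
    rw [e]; exact isCoprime_den_div_pow p hpN _ (m + 1)
  have hpxt' : ∀ t : Fin p, IsCoprime (((p : ℚ) * ((x - t) / p) : ℚ).den : ℤ) (N : ℤ) := by
    intro t
    have e : (p : ℚ) * ((x - t) / p) = (((-(a.val : ℤ)) - (p : ℤ) ^ m * (t : ℕ) : ℤ) : ℚ) / (p : ℚ) ^ m := by
      rw [mul_div_cancel₀ _ hp0, hxdef]; push_cast; field_simp
    rw [e]; exact isCoprime_den_div_pow p hpN _ m
  simp only [mttNu_def, hxt]
  simp only [hcs]
  rw [← Finset.mul_sum, Finset.sum_sub_distrib, ← Finset.mul_sum,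
    ← imCoordPadic_sum _ _ (fun t _ ↦ Wsum_iota_one_mem hV hj _ _ (hxt' t)),
    ← imCoordPadic_sum _ _ (fun t _ ↦ Wsum_iota_p_mem hV hj _ _ (hpxt' t)),
    sum_Wsum_iota_one hpN g (hg.heckeT_eq_coeff_smul hp) j _ x, sum_Wsum_iota_p g j _ x]
  -- push `λ` through `a_p W¹ − p^{n+1} W^p`
  have hreal : ((qExpansion 1 ⇑g).coeff p).im = 0 := hg.cuspCoeff_im_eq_zero p
  have hW1 := Wsum_iota_one_mem (p := p) hV hj ((p : ℚ) ^ m) x hx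
  have hWp := Wsum_iota_p_mem (p := p) hV hj ((p : ℚ) ^ m) x hpx
  have epow : (p : ℂ) ^ ((n : ℤ) + 2 - 1) = ((((p : ℚ) ^ (n + 1) : ℚ)) : ℂ) := by
    rw [show ((n : ℤ) + 2 - 1) = ((n + 1 : ℕ) : ℤ) by push_cast; ring, zpow_natCast]
    push_cast; rfl
  have hWp' : ((((p : ℚ) ^ (n + 1) : ℚ)) : ℂ) * Wsum (iota N (N * p) p (n + 2) dvd_rfl g) j
      ((p : ℚ) ^ m) x ∈ imCoordSubmodule K' Ω := by
    rw [← Rat.smul_def]; exact Submodule.smul_mem _ _ hWp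
  have haW : (qExpansion 1 ⇑g).coeff p * Wsum (iota N (N * p) 1 (n + 2)
      (mul_dvd_mul_left N (one_dvd p)) g) j ((p : ℚ) ^ m) x ∈ imCoordSubmodule K' Ω := by
    rw [mem_imCoordSubmodule]
    have ha' : (qExpansion 1 ⇑g).coeff p = ((((qExpansion 1 ⇑g).coeff p).re : ℝ) : ℂ) :=
      Complex.ext (by simp) (by simp [hreal])
    have e : ((((qExpansion 1 ⇑g).coeff p * Wsum (iota N (N * p) 1 (n + 2)
        (mul_dvd_mul_left N (one_dvd p)) g) j ((p : ℚ) ^ m) x).im / Ω : ℝ) : ℂ) =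
        (qExpansion 1 ⇑g).coeff p * (((Wsum (iota N (N * p) 1 (n + 2)
          (mul_dvd_mul_left N (one_dvd p)) g) j ((p : ℚ) ^ m) x).im / Ω : ℝ) : ℂ) := by
      rw [mul_im, hreal, zero_mul, add_zero]
      conv_rhs => rw [ha']
      push_cast; ring
    rw [e]
    exact mul_mem (hK (coeff_mem_coeffField g p)) hW1
  rw [epow, imCoordPadic_sub haW hWp',
    imCoordPadic_mul_of_im_eq_zero (hK (coeff_mem_coeffField g p)) hreal hW1,
    imCoordPadic_ratCast_mul _ hWp]
  -- the algebra `υ⁻¹^{m+1} [(ι a_p − cι) w¹ − p^{n+1} w^p] = υ⁻¹^m [w¹ − cι w^p]`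
  set w1 := imCoordPadic K' ι Ω (Wsum (iota N (N * p) 1 (n + 2) (mul_dvd_mul_left N (one_dvd p)) g) j
    ((p : ℚ) ^ m) x)
  set wp := imCoordPadic K' ι Ω (Wsum (iota N (N * p) p (n + 2) dvd_rfl g) j ((p : ℚ) ^ m) x)
  have e1 : ι ⟨(qExpansion 1 ⇑g).coeff p, hK (coeff_mem_coeffField g p)⟩ = υ + cι := by
    rw [← hυ]; ring
  rw [e1]
  push_cast
  rw [← hυc, pow_succ]
  field_simp
  ring

/-- The `p`-adic size of the binomial coefficients of `W_j`: at `x = −a/pᵐ` (so `−pᵐx = a ∈ ℕ`),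
`‖C(j,l) (pᵐ)ˡ (−pᵐ x)^{j−l}‖_p ≤ p^{−ml}`. [folklore] -/
theorem norm_ratCast_coeff_le {x : ℚ} {m : ℕ} {A : ℕ} (hxa : -((p : ℚ) ^ m * x) = A) (j l : ℕ) :
    ‖((((j.choose l : ℚ) * ((p : ℚ) ^ m) ^ l * (-((p : ℚ) ^ m * x)) ^ (j - l) : ℚ)) : ℚ_[p])‖ ≤
      ((p : ℝ) ^ (-(m : ℤ))) ^ l := by
  have hp : p.Prime := Fact.out
  rw [hxa]
  have e : ((((j.choose l : ℚ) * ((p : ℚ) ^ m) ^ l * (A : ℚ) ^ (j - l) : ℚ)) : ℚ_[p]) =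
      (((j.choose l * A ^ (j - l) : ℕ) : ℤ) : ℚ_[p]) * ((p : ℚ_[p]) ^ m) ^ l := by
    push_cast; ring
  rw [e, norm_mul, norm_pow, Padic.norm_p_pow]
  calc _ ≤ 1 * ((p : ℝ) ^ (-(m : ℤ))) ^ l :=
        mul_le_mul_of_nonneg_right (Padic.norm_int_le_one _) (by positivity)
    _ = _ := one_mul _

omit [NeZero N] in
/-- `−pᵐ · (−a/pᵐ) = a`. [folklore] -/
theorem neg_pow_mul_cusp (m : ℕ) (a : ZMod (p ^ m)) :
    -((p : ℚ) ^ m * ((((-(a.val : ℤ) : ℤ) : ℚ) / (p : ℚ) ^ m))) = (a.val : ℕ) := by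
  have hp : p.Prime := Fact.out
  have hp0 : (p : ℚ) ^ m ≠ 0 := pow_ne_zero _ (by exact_mod_cast hp.ne_zero)
  rw [mul_div_cancel₀ _ hp0]
  push_cast
  ring

/-- **Boundedness of the moment distributions** (Mazur–Tate–Teitelbaum 1986, §I.10–I.11: the
measure attached to an ordinary, i.e. unit-root, stabilisation is bounded): if the ray moments
`λ(∫_r^{i∞} g zˡ dz)`, `l ≤ n`, `gcd(den r, N) = 1`, are bounded by `B` (bounded denominators,
`IsNewform0.exists_fg_rayMoment_rat_mem` with `exists_norm_imCoordPadic_le_of_fg`) and `‖υ‖ = 1`,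
then `‖ν_j(a + pᵐℤ_p)‖ ≤ (1 + ‖cι‖ p^{n+1}) B` for all `j ≤ n`, `m`, `a`. [cite: MazurTateTeitelbaum1986Invent, §I.11] -/
theorem norm_mttNu_le (hpN : ¬ p ∣ N)
    (hV : ∀ l ≤ n, ∀ r : ℚ, IsCoprime (r.den : ℤ) (N : ℤ) → rayMoment ⇑g l r ∈ imCoordSubmodule K' Ω)
    {B : ℝ} (hB0 : 0 ≤ B)
    (hB : ∀ l ≤ n, ∀ r : ℚ, IsCoprime (r.den : ℤ) (N : ℤ) → ‖imCoordPadic K' ι Ω (rayMoment ⇑g l r)‖ ≤ B)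
    (hυ1 : ‖υ‖ = 1) {j : ℕ} (hj : j ≤ n) (m : ℕ) (a : ZMod (p ^ m)) :
    ‖mttNu p g K' ι Ω υ cι j m a‖ ≤ (1 + ‖cι‖ * (p : ℝ) ^ (n + 1)) * B := by
  have hp : p.Prime := Fact.out
  have hp1 : (1 : ℝ) ≤ p := by exact_mod_cast hp.one_lt.le
  set x : ℚ := ((-(a.val : ℤ) : ℤ) : ℚ) / (p : ℚ) ^ m with hxdef
  have hxa : -((p : ℚ) ^ m * x) = (a.val : ℕ) := neg_pow_mul_cusp m a
  have hx : IsCoprime (x.den : ℤ) (N : ℤ) := isCoprime_den_div_pow p hpN _ m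
  have hpx : IsCoprime (((p : ℚ) * x).den : ℤ) (N : ℤ) := by
    have e : (p : ℚ) * x = (((-(a.val : ℤ)) * p : ℤ) : ℚ) / (p : ℚ) ^ m := by
      rw [hxdef]; push_cast; ring
    rw [e]; exact isCoprime_den_div_pow p hpN _ m
  have hpm : ((p : ℝ) ^ (-(m : ℤ))) ≤ 1 := by
    rw [zpow_neg, zpow_natCast]; exact inv_le_one_of_one_le₀ (one_le_pow₀ hp1)
  have hpm0 : 0 ≤ ((p : ℝ) ^ (-(m : ℤ))) := by positivity
  have hpinv : ∀ l ≤ n, ‖(((p : ℚ_[p]) ^ (l + 1))⁻¹)‖ ≤ (p : ℝ) ^ (n + 1) := fun l hl ↦ by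
    rw [norm_inv, norm_pow, Padic.norm_p, inv_pow, inv_inv]
    exact pow_le_pow_right₀ hp1 (by omega)
  -- the two expanded sums
  have h1 : ‖imCoordPadic K' ι Ω (Wsum (iota N (N * p) 1 (n + 2) (mul_dvd_mul_left N (one_dvd p)) g) j
      ((p : ℚ) ^ m) x)‖ ≤ B := by
    rw [imCoordPadic_Wsum_iota_one hV hj _ x hx]
    refine IsUltrametricDist.norm_sum_le_of_forall_le_of_nonneg hB0 fun l hl ↦ ?_
    have hl' : l ≤ n := (Nat.lt_succ_iff.mp (Finset.mem_range.mp hl)).trans hj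
    have hq := (norm_ratCast_coeff_le hxa j l).trans (pow_le_one₀ hpm0 hpm)
    have hv := hB l hl' x hx
    rw [norm_mul]
    calc _ ≤ 1 * B := by gcongr
      _ = B := one_mul B
  have h2 : ‖imCoordPadic K' ι Ω (Wsum (iota N (N * p) p (n + 2) dvd_rfl g) j ((p : ℚ) ^ m) x)‖ ≤
      (p : ℝ) ^ (n + 1) * B := by
    rw [imCoordPadic_Wsum_iota_p hV hj _ x hpx]
    refine IsUltrametricDist.norm_sum_le_of_forall_le_of_nonneg (by positivity) fun l hl ↦ ?_
    have hl' : l ≤ n := (Nat.lt_succ_iff.mp (Finset.mem_range.mp hl)).trans hj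
    have hq := (norm_ratCast_coeff_le hxa j l).trans (pow_le_one₀ hpm0 hpm)
    have hv := hB l hl' _ hpx
    have hi := hpinv l hl'
    rw [Rat.cast_mul ((j.choose l : ℚ) * ((p : ℚ) ^ m) ^ l * (-((p : ℚ) ^ m * x)) ^ (j - l))
        (((p : ℚ) ^ (l + 1))⁻¹), Rat.cast_inv, Rat.cast_pow, Rat.cast_natCast, norm_mul, norm_mul]
    calc _ ≤ 1 * (p : ℝ) ^ (n + 1) * B := by gcongr
      _ = _ := by ring
  rw [mttNu_def, norm_mul, norm_pow, norm_inv, hυ1, inv_one, one_pow, one_mul]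
  calc _ ≤ ‖imCoordPadic K' ι Ω (Wsum (iota N (N * p) 1 (n + 2) (mul_dvd_mul_left N (one_dvd p)) g) j
        ((p : ℚ) ^ m) x)‖ + ‖cι * imCoordPadic K' ι Ω (Wsum (iota N (N * p) p (n + 2) dvd_rfl g) j
          ((p : ℚ) ^ m) x)‖ := norm_sub_le _ _
    _ ≤ B + ‖cι‖ * ((p : ℝ) ^ (n + 1) * B) := by rw [norm_mul]; gcongr
    _ = _ := by ring

/-- **Admissibility (slope `0`) of the moment family**: `‖ν_j(a + pᵐ) − aʲ ν_0(a + pᵐ)‖ ≤ C p⁻ᵐ`,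
`C = (1 + ‖cι‖ p^{n+1}) B` — in `W_j − aʲ W_0` only the terms `l ≥ 1` survive, each carrying
`(pᵐ)ˡ` (Mazur–Tate–Teitelbaum 1986, §I.11; Višik 1976). [cite: MazurTateTeitelbaum1986Invent, §I.11] -/
theorem norm_mttNu_sub_pow_mul_le (hpN : ¬ p ∣ N)
    (hV : ∀ l ≤ n, ∀ r : ℚ, IsCoprime (r.den : ℤ) (N : ℤ) → rayMoment ⇑g l r ∈ imCoordSubmodule K' Ω)
    {B : ℝ} (hB0 : 0 ≤ B)
    (hB : ∀ l ≤ n, ∀ r : ℚ, IsCoprime (r.den : ℤ) (N : ℤ) → ‖imCoordPadic K' ι Ω (rayMoment ⇑g l r)‖ ≤ B)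
    (hυ1 : ‖υ‖ = 1) {j : ℕ} (hj : j ≤ n) (m : ℕ) (a : ZMod (p ^ m)) :
    ‖mttNu p g K' ι Ω υ cι j m a - ((a.val : ℕ) : ℚ_[p]) ^ j * mttNu p g K' ι Ω υ cι 0 m a‖ ≤
      (1 + ‖cι‖ * (p : ℝ) ^ (n + 1)) * B * (p : ℝ) ^ (-(m : ℤ)) := by
  have hp : p.Prime := Fact.out
  have hp1 : (1 : ℝ) ≤ p := by exact_mod_cast hp.one_lt.le
  set x : ℚ := ((-(a.val : ℤ) : ℤ) : ℚ) / (p : ℚ) ^ m with hxdef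
  have hxa : -((p : ℚ) ^ m * x) = (a.val : ℕ) := neg_pow_mul_cusp m a
  have hx : IsCoprime (x.den : ℤ) (N : ℤ) := isCoprime_den_div_pow p hpN _ m
  have hpx : IsCoprime (((p : ℚ) * x).den : ℤ) (N : ℤ) := by
    have e : (p : ℚ) * x = (((-(a.val : ℤ)) * p : ℤ) : ℚ) / (p : ℚ) ^ m := by
      rw [hxdef]; push_cast; ring
    rw [e]; exact isCoprime_den_div_pow p hpN _ m
  have hpm : ((p : ℝ) ^ (-(m : ℤ))) ≤ 1 := by
    rw [zpow_neg, zpow_natCast]; exact inv_le_one_of_one_le₀ (one_le_pow₀ hp1)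
  have hpm0 : 0 ≤ ((p : ℝ) ^ (-(m : ℤ))) := by positivity
  have h0n : 0 ≤ n := Nat.zero_le n
  have hpinv : ∀ l ≤ n, ‖(((p : ℚ_[p]) ^ (l + 1))⁻¹)‖ ≤ (p : ℝ) ^ (n + 1) := fun l hl ↦ by
    rw [norm_inv, norm_pow, Padic.norm_p, inv_pow, inv_inv]
    exact pow_le_pow_right₀ hp1 (by omega)
  -- coefficient bound for `l + 1 ≥ 1`: `≤ p^{-m}`
  have hcoef : ∀ l : ℕ, ‖((((j.choose (l + 1) : ℚ) * ((p : ℚ) ^ m) ^ (l + 1) *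
      (-((p : ℚ) ^ m * x)) ^ (j - (l + 1)) : ℚ)) : ℚ_[p])‖ ≤ (p : ℝ) ^ (-(m : ℤ)) := fun l ↦
    (norm_ratCast_coeff_le hxa j (l + 1)).trans (by
      rw [pow_succ]
      exact mul_le_of_le_one_left hpm0 (pow_le_one₀ hpm0 hpm))
  -- the `l = 0` coefficients
  have e0 : ((((Nat.choose 0 0 : ℚ) * ((p : ℚ) ^ m) ^ 0 * (-((p : ℚ) ^ m * x)) ^ (0 - 0) : ℚ)) : ℚ_[p]) = 1 := by
    rw [Nat.choose_zero_right, Nat.cast_one, one_mul, pow_zero, one_mul, Nat.sub_zero, pow_zero, Rat.cast_one]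
  have ej : ((((j.choose 0 : ℚ) * ((p : ℚ) ^ m) ^ 0 * (-((p : ℚ) ^ m * x)) ^ (j - 0) : ℚ)) : ℚ_[p]) =
      ((a.val : ℕ) : ℚ_[p]) ^ j := by
    rw [Nat.choose_zero_right, Nat.cast_one, one_mul, pow_zero, one_mul, Nat.sub_zero, hxa, Rat.cast_pow,
      Rat.cast_natCast]
  have e0' : ((((Nat.choose 0 0 : ℚ) * ((p : ℚ) ^ m) ^ 0 * (-((p : ℚ) ^ m * x)) ^ (0 - 0) *
      ((p : ℚ) ^ (0 + 1))⁻¹ : ℚ)) : ℚ_[p]) = ((p : ℚ_[p]) ^ 1)⁻¹ := by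
    rw [Nat.choose_zero_right, Nat.cast_one, one_mul, pow_zero, one_mul, Nat.sub_zero, pow_zero, one_mul,
      zero_add, Rat.cast_inv, Rat.cast_pow, Rat.cast_natCast]
  have ej' : ((((j.choose 0 : ℚ) * ((p : ℚ) ^ m) ^ 0 * (-((p : ℚ) ^ m * x)) ^ (j - 0) *
      ((p : ℚ) ^ (0 + 1))⁻¹ : ℚ)) : ℚ_[p]) = ((a.val : ℕ) : ℚ_[p]) ^ j * ((p : ℚ_[p]) ^ 1)⁻¹ := by
    rw [Nat.choose_zero_right, Nat.cast_one, one_mul, pow_zero, one_mul, Nat.sub_zero, zero_add, hxa,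
      Rat.cast_mul, Rat.cast_pow, Rat.cast_natCast, Rat.cast_inv, Rat.cast_pow, Rat.cast_natCast]
  -- the differences of the expanded sums
  have h1 : ‖imCoordPadic K' ι Ω (Wsum (iota N (N * p) 1 (n + 2) (mul_dvd_mul_left N (one_dvd p)) g) j
      ((p : ℚ) ^ m) x) - ((a.val : ℕ) : ℚ_[p]) ^ j * imCoordPadic K' ι Ω (Wsum (iota N (N * p) 1 (n + 2)
        (mul_dvd_mul_left N (one_dvd p)) g) 0 ((p : ℚ) ^ m) x)‖ ≤ B * (p : ℝ) ^ (-(m : ℤ)) := by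
    rw [imCoordPadic_Wsum_iota_one hV hj _ x hx, imCoordPadic_Wsum_iota_one hV h0n _ x hx,
      Finset.sum_range_one, Finset.sum_range_succ' _ j, e0, ej, one_mul, add_sub_cancel_right]
    refine IsUltrametricDist.norm_sum_le_of_forall_le_of_nonneg (by positivity) fun l hl ↦ ?_
    have hl' : l + 1 ≤ n := (Nat.succ_le_of_lt (Finset.mem_range.mp hl)).trans hj
    have hq := hcoef l
    have hv := hB (l + 1) hl' x hx
    rw [norm_mul]
    calc _ ≤ (p : ℝ) ^ (-(m : ℤ)) * B := by gcongr
      _ = _ := mul_comm _ _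
  have h2 : ‖imCoordPadic K' ι Ω (Wsum (iota N (N * p) p (n + 2) dvd_rfl g) j ((p : ℚ) ^ m) x) -
      ((a.val : ℕ) : ℚ_[p]) ^ j * imCoordPadic K' ι Ω (Wsum (iota N (N * p) p (n + 2) dvd_rfl g) 0
        ((p : ℚ) ^ m) x)‖ ≤ (p : ℝ) ^ (n + 1) * B * (p : ℝ) ^ (-(m : ℤ)) := by
    rw [imCoordPadic_Wsum_iota_p hV hj _ x hpx, imCoordPadic_Wsum_iota_p hV h0n _ x hpx,
      Finset.sum_range_one, Finset.sum_range_succ' _ j, e0', ej', mul_assoc, add_sub_cancel_right]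
    refine IsUltrametricDist.norm_sum_le_of_forall_le_of_nonneg (by positivity) fun l hl ↦ ?_
    have hl' : l + 1 ≤ n := (Nat.succ_le_of_lt (Finset.mem_range.mp hl)).trans hj
    have hq := hcoef l
    have hv := hB (l + 1) hl' _ hpx
    have hi := hpinv (l + 1) hl'
    rw [Rat.cast_mul ((j.choose (l + 1) : ℚ) * ((p : ℚ) ^ m) ^ (l + 1) * (-((p : ℚ) ^ m * x)) ^ (j - (l + 1)))
        (((p : ℚ) ^ (l + 1 + 1))⁻¹), Rat.cast_inv, Rat.cast_pow, Rat.cast_natCast, norm_mul, norm_mul]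
    calc _ ≤ (p : ℝ) ^ (-(m : ℤ)) * (p : ℝ) ^ (n + 1) * B := by gcongr
      _ = _ := by ring
  have e : mttNu p g K' ι Ω υ cι j m a - ((a.val : ℕ) : ℚ_[p]) ^ j * mttNu p g K' ι Ω υ cι 0 m a =
      (υ⁻¹) ^ m * ((imCoordPadic K' ι Ω (Wsum (iota N (N * p) 1 (n + 2) (mul_dvd_mul_left N (one_dvd p)) g) j
        ((p : ℚ) ^ m) x) - ((a.val : ℕ) : ℚ_[p]) ^ j * imCoordPadic K' ι Ω (Wsum (iota N (N * p) 1 (n + 2)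
          (mul_dvd_mul_left N (one_dvd p)) g) 0 ((p : ℚ) ^ m) x)) -
        cι * (imCoordPadic K' ι Ω (Wsum (iota N (N * p) p (n + 2) dvd_rfl g) j ((p : ℚ) ^ m) x) -
          ((a.val : ℕ) : ℚ_[p]) ^ j * imCoordPadic K' ι Ω (Wsum (iota N (N * p) p (n + 2) dvd_rfl g) 0
            ((p : ℚ) ^ m) x))) := by
    rw [mttNu_def, mttNu_def]; ring
  rw [e, norm_mul, norm_pow, norm_inv, hυ1, inv_one, one_pow, one_mul]
  calc _ ≤ ‖imCoordPadic K' ι Ω (Wsum (iota N (N * p) 1 (n + 2) (mul_dvd_mul_left N (one_dvd p)) g) j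
        ((p : ℚ) ^ m) x) - ((a.val : ℕ) : ℚ_[p]) ^ j * imCoordPadic K' ι Ω (Wsum (iota N (N * p) 1 (n + 2)
          (mul_dvd_mul_left N (one_dvd p)) g) 0 ((p : ℚ) ^ m) x)‖ +
        ‖cι * (imCoordPadic K' ι Ω (Wsum (iota N (N * p) p (n + 2) dvd_rfl g) j ((p : ℚ) ^ m) x) -
          ((a.val : ℕ) : ℚ_[p]) ^ j * imCoordPadic K' ι Ω (Wsum (iota N (N * p) p (n + 2) dvd_rfl g) 0
            ((p : ℚ) ^ m) x))‖ := norm_sub_le _ _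
    _ ≤ B * (p : ℝ) ^ (-(m : ℤ)) + ‖cι‖ * ((p : ℝ) ^ (n + 1) * B * (p : ℝ) ^ (-(m : ℤ))) := by
        rw [norm_mul]; gcongr
    _ = _ := by ring

end Distributions

/-! ### The Mazur–Tate–Teitelbaum `p`-adic `L`-function in weight `n + 2 ≥ 4` -/

section Main

variable {N : ℕ} [NeZero N] {p : ℕ} [Fact p.Prime] {n : ℕ}

omit [Fact p.Prime] in
/-- `τ` is even (`τ = 2` for `p = 2`, `p − 1` for odd `p`), so `τ ∣ j ⇒ j` even. [folklore] -/
theorem even_of_torsionOrder_dvd [Fact p.Prime] {j : ℕ} (hj : torsionOrder p ∣ j) : Even j := by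
  have hτ : Even (torsionOrder p) := by
    rw [torsionOrder_eq]
    split_ifs with h
    · exact ⟨1, rfl⟩
    · exact (Fact.out : p.Prime).even_sub_one h
  obtain ⟨i, rfl⟩ := hj
  exact hτ.mul_right i

/-- **The Mazur–Tate–Teitelbaum `p`-adic `L`-function of a `p`-ordinary newform of weight
`n + 2 ≥ 4` (minus sign), with its interpolation property at the characters `x ↦ ⟨x⟩ʲ`**
(Mazur–Tate–Teitelbaum 1986, §I.10–I.14, the case `χ = 1` of (14.3) in weight `k = n + 2`;
Delbourgo 2008, Thm. 2.2; Bellaïche, *The Eigenbook*, Thm. 6.7.9 / Cor. 6.7.10 for the slope-`0`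
stabilisation).  Let `g ∈ S_{n+2}(Γ₀(N))` be a newform of even weight `n + 2 ≥ 4`, `p ∤ N` prime,
`K' ⊆ ℂ` a field containing `K_g` with an embedding `ι : K' → ℚ_p`, and `u ∈ K'` a root of
`X² − a_p X + p^{n+1}` with `‖ι(u)‖ = 1` (the unit root: `g` is `ι`-ordinary).  Then there are a
bounded power series `L ∈ ℚ_p⟦T⟧` — the transform `∫_{ℤ_p^×} (1 + T)^{ℓ(x)} dμ⁻(x)` of the minus
measure `μ⁻ = ν_0` of the `p`-stabilisation `g − (a_p − u) g(pz)` (`mttNu`), `γ = 1 + p^{e₀}` — and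
the period `Ω = Ω⁻_g ∈ ℝ^×` of `g` (`Im` of every element of the `K_g`-plane of cuspidal period
values of `g` lies in `K_g Ω`), such that for every `0 ≤ j ≤ n` with `τ ∣ j` (so `j` even and
`xʲ = ⟨x⟩ʲ` on `ℤ_p^×`):

  `L(γʲ − 1) = ι( (1 − pʲ/u)(1 − p^{n−j}/u) · Im(i^{j+1} Λ(g, j+1)) / Ω )`,

where `Λ(g, s) = ∫₀^∞ g(it) t^{s−1} dt` (`completedLValue`), `i^{j+1}Λ(g, j+1) ∈ K_g Ω i` is purely
imaginary (last conjunct), and `(1 − pʲ/u)(1 − p^{n−j}/u)` is the `p`-adic multiplier of the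
stabilisation (`completedLValue_pStabilisation`: `Λ(g − (a_p − u)g(p·), j+1) = (1 − p^{n−j}/u)Λ(g, j+1)`).
Ingredients: the distribution relation, boundedness and admissibility of the moment family
`mttNu` (`sum_fiber_mttNu`, `norm_mttNu_le`, `norm_mttNu_sub_pow_mul_le`, from Manin's bounded
denominators `IsNewform0.exists_fg_rayMoment_rat_mem` and Shimura's theorem
`IsNewform0.exists_re_im_mem_span_cuspidalLatticeK`), and the abstract `p`-adic analysis of
`PAdicMeasureMoments` (`L_μ(γʲ − 1) = ν_j(ℤ_p) − ν_j(pℤ_p)`). [cite: MazurTateTeitelbaum1986Invent, §I.14 (14.3)] -/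
theorem exists_mtt_powerSeries_weightK (hpN : ¬ p ∣ N) (hn : Even n) (hn0 : n ≠ 0)
    {g : CuspForm (Gamma0 N) (n + 2)} (hg : IsNewform0 g)
    (K' : IntermediateField ℚ ℂ) (ι : K' →+* ℚ_[p]) (hK : coeffField g ≤ K')
    {u : ℂ} (huK : u ∈ K') (hu : u ^ 2 - (qExpansion 1 ⇑g).coeff p * u + (p : ℂ) ^ (n + 1) = 0)
    (hunit : ‖ι ⟨u, huK⟩‖ = 1) :
    ∃ (L : PowerSeries ℚ_[p]) (C : ℝ) (Ω : ℝ), Ω ≠ 0 ∧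
      (∀ k, ‖PowerSeries.coeff k L‖ ≤ C) ∧
      (∀ z ∈ Submodule.span (coeffField g)
        ((fun φ : Module.Dual ℂ (CuspForm (Gamma0 N) (n + 2)) ↦ φ g) '' (cuspidalLatticeK (N := N) n)),
        ∃ q : ℂ, q ∈ coeffField g ∧ ((z.im : ℝ) : ℂ) = q * Ω) ∧
      ∀ j : ℕ, j ≤ n → torsionOrder p ∣ j →
        ∃ hmem : (1 - (p : ℂ) ^ j / u) * (1 - (p : ℂ) ^ (n - j) / u) *
            ((((I ^ (j + 1) * completedLValue g (j + 1)).im / Ω : ℝ)) : ℂ) ∈ K',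
          padicEval L (((cyclotomicGenerator p : ℕ) : ℚ_[p]) ^ j - 1) = ι ⟨_, hmem⟩ ∧
          ((((I ^ (j + 1) * completedLValue g (j + 1)).im : ℝ)) : ℂ) * I =
            I ^ (j + 1) * completedLValue g (j + 1) := by
  have hp : p.Prime := Fact.out
  -- ### periods and bounded denominators
  obtain ⟨Ωp, Ωm, hΩp, hΩm, hcoord⟩ := hg.exists_re_im_mem_span_cuspidalLatticeK hn hn0
  obtain ⟨M, hMfg, hMR, hM⟩ := hg.exists_fg_rayMoment_rat_mem hn hn0
  have hΩmC : (Ωm : ℂ) ≠ 0 := by exact_mod_cast hΩm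
  have hR0V : ∀ z ∈ Submodule.span (coeffField g)
      ((fun φ : Module.Dual ℂ (CuspForm (Gamma0 N) (n + 2)) ↦ φ g) '' (cuspidalLatticeK (N := N) n)),
      z ∈ imCoordSubmodule K' Ωm := by
    intro z hz
    obtain ⟨q, hq, hqe⟩ := (hcoord z hz).2
    rw [mem_imCoordSubmodule]
    have e : (((z.im / Ωm : ℝ)) : ℂ) = q := by
      push_cast
      rw [hqe, mul_div_assoc, div_self hΩmC, mul_one]
    rw [e]
    exact hK hq
  have hV : ∀ l ≤ n, ∀ r : ℚ, IsCoprime (r.den : ℤ) (N : ℤ) → rayMoment ⇑g l r ∈ imCoordSubmodule K' Ωm :=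
    fun l hl r hr ↦ hR0V _ (hMR _ (hM r hr l hl))
  obtain ⟨B, hB0, hB⟩ := exists_norm_imCoordPadic_le_of_fg (ι := ι) hMfg (fun z hz ↦ hR0V z (hMR z hz))
  have hB' : ∀ l ≤ n, ∀ r : ℚ, IsCoprime (r.den : ℤ) (N : ℤ) →
      ‖imCoordPadic K' ι Ωm (rayMoment ⇑g l r)‖ ≤ B := fun l hl r hr ↦ hB _ (hM r hr l hl)
  -- ### the `p`-adic numbers `υ = ι(u)`, `cι = ι(a_p − u)`
  set uK : K' := ⟨u, huK⟩ with huKdef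
  have hap : (qExpansion 1 ⇑g).coeff p ∈ K' := hK (coeff_mem_coeffField g p)
  set aK : K' := ⟨(qExpansion 1 ⇑g).coeff p, hap⟩ with haKdef
  set υ : ℚ_[p] := ι uK with hυdef
  set cι : ℚ_[p] := ι (aK - uK) with hcιdef
  have hυ0 : υ ≠ 0 := fun h ↦ by rw [h, norm_zero] at hunit; exact zero_ne_one hunit
  have huK0 : uK ≠ 0 := fun h ↦ hυ0 (by rw [hυdef, h, map_zero])
  have hu0 : u ≠ 0 := fun h ↦ huK0 (Subtype.ext h)
  have hυ : ι aK - cι = υ := by rw [hcιdef, map_sub]; ring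
  have hprod : uK * (aK - uK) = (p : K') ^ (n + 1) := by
    apply Subtype.ext
    push_cast
    rw [huKdef, haKdef]
    dsimp only
    linear_combination -hu
  have hυc : υ * cι = (p : ℚ_[p]) ^ (n + 1) := by
    rw [hυdef, hcιdef, ← map_mul, hprod, map_pow, map_natCast]
  -- ### the measure `μ = ν_0` and its transform
  have hdist := fun (m : ℕ) (a : ZMod (p ^ m)) ↦
    sum_fiber_mttNu (K' := K') (ι := ι) (Ω := Ωm) hpN hg hK hV hυ hυc hυ0 (Nat.zero_le n) m a
  have hC := fun (m : ℕ) (a : ZMod (p ^ m)) ↦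
    norm_mttNu_le (K' := K') (ι := ι) (Ω := Ωm) (cι := cι) hpN hV hB0 hB' hunit (Nat.zero_le n) m a
  obtain ⟨L, hLC, hL, -, -⟩ := exists_powerSeries_of_bounded_distribution' hdist hC
  refine ⟨L, _, Ωm, hΩm, hLC, fun z hz ↦ (hcoord z hz).2, fun j hj hτ ↦ ?_⟩
  -- ### the `j`-th moment
  have heven : Even j := even_of_torsionOrder_dvd hτ
  have hreal : HasRealCoefficients g := hg.cuspCoeff_im_eq_zero
  have hre : (I ^ (j + 1) * completedLValue g (j + 1)).re = 0 := (I_pow_mul_completedLValue_re_im g hreal j).2 heven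
  have himI : ((((I ^ (j + 1) * completedLValue g (j + 1)).im : ℝ)) : ℂ) * I =
      I ^ (j + 1) * completedLValue g (j + 1) :=
    Complex.ext (by simp [hre]) (by simp)
  have hνdist := fun (m : ℕ) (a : ZMod (p ^ m)) ↦
    sum_fiber_mttNu (K' := K') (ι := ι) (Ω := Ωm) hpN hg hK hV hυ hυc hυ0 hj m a
  have hν := fun (m : ℕ) (a : ZMod (p ^ m)) ↦
    norm_mttNu_sub_pow_mul_le (K' := K') (ι := ι) (Ω := Ωm) (cι := cι) hpN hV hB0 hB' hunit hj m a
  have hsum := hasSum_coeff_mul_cyclotomicGenerator_pow_sub_one hC hL hτ hνdist hν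
  -- the moment at the cusp `0`
  have h0mem : rayMoment ⇑g j 0 ∈ imCoordSubmodule K' Ωm := by
    have := hV j hj 0 (by rw [Rat.den_zero]; exact isCoprime_one_left)
    simpa using this
  have hval := mttNu_zero_sub_mttNu_one (K' := K') (ι := ι) (Ω := Ωm) (υ := υ) (cι := cι) j h0mem
  -- the element of `K'`
  set b : ℂ := ((((I ^ (j + 1) * completedLValue g (j + 1)).im / Ωm : ℝ)) : ℂ) with hbdef
  have hbmem : b ∈ K' := by
    have h := h0mem
    rw [mem_imCoordSubmodule, rayMoment_zero] at h
    exact h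
  set bK : K' := ⟨b, hbmem⟩ with hbKdef
  set eK : K' := (1 - (p : K') ^ j / uK) * (1 - (p : K') ^ (n - j) / uK) * bK with heKdef
  have heK : (eK : ℂ) = (1 - (p : ℂ) ^ j / u) * (1 - (p : ℂ) ^ (n - j) / u) * b := by
    rw [heKdef]; push_cast; rw [huKdef, hbKdef]
  have hmem : (1 - (p : ℂ) ^ j / u) * (1 - (p : ℂ) ^ (n - j) / u) * b ∈ K' := by rw [← heK]; exact eK.2
  refine ⟨hmem, ?_, himI⟩
  -- ### `L(γʲ − 1) = ν_j(ℤ_p) − ν_j(pℤ_p) = ι(e)`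
  have hlam : imCoordPadic K' ι Ωm (rayMoment ⇑g j 0) = ι bK := by
    rw [imCoordPadic_of_mem h0mem]
    congr 1
    apply Subtype.ext
    simp only [hbKdef, hbdef, rayMoment_zero]
  have hcιe : cι = (p : ℚ_[p]) ^ (n + 1) * υ⁻¹ := by
    field_simp
    rw [mul_comm, hυc]
  rw [show ι ⟨_, hmem⟩ = ι eK from congr_arg ι (Subtype.ext heK.symm), padicEval, hsum.tsum_eq, hval, hlam,
    heKdef, map_mul, map_mul, map_sub, map_sub, map_one, map_div₀, map_div₀, map_pow, map_pow, map_natCast,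
    ← hυdef, hcιe]
  have hpQ : (p : ℚ_[p]) ≠ 0 := by exact_mod_cast hp.ne_zero
  obtain ⟨d, rfl⟩ : ∃ d, n = j + d := ⟨n - j, by omega⟩
  rw [Nat.add_sub_cancel_left]
  field_simp
  ring

end Main

end Literature.NumberTheory.EllipticCurves.ModularForms
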